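import Summits.CriticalPhenomena.PercolationContinuityZ3.Theorems.PercNearOneGluingNoHeavyLowerTailSunflowerMultiPetalClutterPendant
import Summits.CriticalPhenomena.PercolationContinuityZ3.Theorems.PercNearOneGluingNoHeavyLowerTailSunflowerMultiPetalBottomSpectator
import Summits.CriticalPhenomena.PercolationContinuityZ3.Theorems.PercNearOneGluingNoHeavyLowerTailSunflowerMultiPetalTypeUnion
import HarnessLib
import HarnessLib.Audit

/-!
# `NoHeavyLowerTail` (crux stmt-CriticalPhenomena-4575), abstract sunflower cubic, `k` petals: the TYPE VECTOR of a coloured clutter and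
# the type-vector form of the bottom-spectator functional — `QKW W = Σ_t lbW t · typeCount W t`

Support file (seat `prim-l12-p2` gen 37; `--supports stmt-CriticalPhenomena-4575`; companion of `…MultiPetalTypeUnion` (p385801: `CType`, `ctAdd`,
`lbW`, `lemmaB_pair_nonneg`), `…MultiPetalClutterPendant` (`MSunflower.ofClutter`) and `…MultiPetalBottomSpectator` (`qK`, `MSunflower.QKW`)).
No `sorry`; nothing is asserted about the crux.  Memo: run/shared/lean/prim/prim-l12/prim-l12-p2/FINDING-g37-UNION-AND-ONE-SUM.md §0, §2, §7.

For a family `E : Fin k → Finset α` of NONEMPTY members and a block `X`, `memCount E X` is the number of members inside `X` and `capOf E X ∈ Fin 3`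
its value capped at 2; the clutter label `(ofClutter E).lab X` is bottom / a petal / top exactly when the cap is 0 / 1 / 2, and two DISJOINT lonely blocks
carry different petals.  Hence on pairwise disjoint blocks the bottom-spectator kernel is a function of the capped counts:
`qK (lab X) (lab Y) (lab Z) = lbW (capOf X, capOf Y, capOf Z)` (`qK_lab_eq_lbW`), and the sub-cube functional is the Lemma-B functional of the TYPE VECTOR:
`QKW W = Σ_t lbW t · typeCount E W t` (`QKW_eq_sum_typeCount`), where `typeCount E W t` counts the ordered 3-partitions of `W` of capped type `t`.
The type vector is nonnegative and invariant under the class swaps (`typeCount_swap12`, `typeCount_swap23`) — exactly the hypotheses of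
`lemmaB_pair_nonneg` (THEOREM A), which the companion union file feeds with it.
-/

namespace Summit.CriticalPhenomena.PercolationContinuityZ3.Theorems.SunflowerPartition

open Finset

variable {α : Type*} [DecidableEq α] [Fintype α] {k : ℕ}

/-! ## Member counts and their caps -/

/-- Number of members of the family inside the block `X`. [this work] -/
def memCount (E : Fin k → Finset α) (X : Finset α) : ℕ := (univ.filter fun i => E i ⊆ X).card

/-- The member count capped at `2`, as an element of `Fin 3`. [this work] -/
def capOf (E : Fin k → Finset α) (X : Finset α) : Fin 3 := ⟨min (memCount E X) 2, by omega⟩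

variable (E : Fin k → Finset α)

omit [Fintype α] in
/-- `2 ≤ memCount` iff two different members lie inside the block. [this work] -/
theorem two_le_memCount_iff (X : Finset α) : 2 ≤ memCount E X ↔ ∃ a b : Fin k, a ≠ b ∧ E a ⊆ X ∧ E b ⊆ X := by
  unfold memCount
  rw [show (2 : ℕ) ≤ (univ.filter fun i => E i ⊆ X).card ↔ 1 < (univ.filter fun i => E i ⊆ X).card from Iff.rfl,
    Finset.one_lt_card_iff]
  constructor
  · rintro ⟨a, b, ha, hb, hab⟩
    exact ⟨a, b, hab, (mem_filter.1 ha).2, (mem_filter.1 hb).2⟩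
  · rintro ⟨a, b, hab, ha, hb⟩
    exact ⟨a, b, mem_filter.2 ⟨mem_univ _, ha⟩, mem_filter.2 ⟨mem_univ _, hb⟩, hab⟩

omit [Fintype α] in
/-- `memCount = 0` iff no member lies inside the block. [this work] -/
theorem memCount_eq_zero_iff (X : Finset α) : memCount E X = 0 ↔ ∀ i, ¬ E i ⊆ X := by
  unfold memCount
  rw [Finset.card_eq_zero, Finset.filter_eq_empty_iff]
  simp only [mem_univ, forall_true_left]

omit [Fintype α] in
/-- `capOf = 0` iff `memCount = 0`. [this work] -/
theorem capOf_eq_zero_iff (X : Finset α) : capOf E X = 0 ↔ memCount E X = 0 := by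
  unfold capOf
  rw [Fin.ext_iff]
  simp only [Fin.val_zero]
  omega

omit [Fintype α] in
/-- `capOf = 2` iff `2 ≤ memCount`. [this work] -/
theorem capOf_eq_two_iff (X : Finset α) : capOf E X = 2 ↔ 2 ≤ memCount E X := by
  unfold capOf
  rw [Fin.ext_iff]
  show min (memCount E X) 2 = 2 ↔ _
  omega

/-- The clutter label is top iff at least two members lie inside the block. [this work] -/
theorem ofClutter_lab_eq_last_iff (X : Finset α) :
    (MSunflower.ofClutter E).lab X = Fin.last (k + 1) ↔ 2 ≤ memCount E X := by
  rw [MSunflower.lab_eq_last_iff, MSunflower.mem_ofClutter_A, two_le_memCount_iff]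

/-- The clutter label is bottom iff no member lies inside the block. [this work] -/
theorem ofClutter_lab_eq_zero_iff (X : Finset α) : (MSunflower.ofClutter E).lab X = 0 ↔ memCount E X = 0 := by
  rw [MSunflower.lab_eq_zero_iff, memCount_eq_zero_iff]
  constructor
  · rintro ⟨_, hV⟩ i hi
    exact hV i ((MSunflower.mem_ofClutter_V E).2 (Or.inl hi))
  · intro h
    refine ⟨fun hA => ?_, fun i hV => ?_⟩
    · obtain ⟨a, b, -, ha, -⟩ := (MSunflower.mem_ofClutter_A E).1 hA
      exact h a ha
    · rcases (MSunflower.mem_ofClutter_V E).1 hV with hi | ⟨a, b, -, ha, -⟩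
      · exact h i hi
      · exact h a ha

/-- **Disjoint lonely blocks carry different petals** (members nonempty). [this work] -/
theorem ofClutter_lab_ne_of_disjoint (hne : ∀ i, (E i).Nonempty) {X Y : Finset α} (hXY : Disjoint X Y)
    (hX0 : (MSunflower.ofClutter E).lab X ≠ 0) (hXt : (MSunflower.ofClutter E).lab X ≠ Fin.last (k + 1)) :
    (MSunflower.ofClutter E).lab X ≠ (MSunflower.ofClutter E).lab Y := by
  intro h
  rcases (MSunflower.ofClutter E).lab_cases X with hA | h0 | ⟨i, hAi, hVi, hli⟩
  · exact hXt (((MSunflower.ofClutter E).lab_eq_last_iff X).2 hA)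
  · exact hX0 h0
  rcases (MSunflower.ofClutter E).lab_cases Y with hA' | h0' | ⟨j, hAj, hVj, hlj⟩
  · exact hXt (h.trans (((MSunflower.ofClutter E).lab_eq_last_iff Y).2 hA'))
  · exact hX0 (h.trans h0')
  · have hij : i = j := petalLab_injective k (hli.symm.trans (h.trans hlj))
    subst hij
    have hiX : E i ⊆ X := by
      rcases (MSunflower.mem_ofClutter_V E).1 hVi with h1 | h2
      · exact h1
      · exact absurd ((MSunflower.mem_ofClutter_A E).2 h2) hAi
    have hiY : E i ⊆ Y := by
      rcases (MSunflower.mem_ofClutter_V E).1 hVj with h1 | h2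
      · exact h1
      · exact absurd ((MSunflower.mem_ofClutter_A E).2 h2) hAj
    obtain ⟨x, hx⟩ := hne i
    exact Finset.disjoint_left.1 hXY (hiX hx) (hiY hx)

/-- For disjoint blocks, equal labels means both bottom or both top. [this work] -/
theorem ofClutter_lab_eq_lab_iff (hne : ∀ i, (E i).Nonempty) {X Y : Finset α} (hXY : Disjoint X Y) :
    (MSunflower.ofClutter E).lab X = (MSunflower.ofClutter E).lab Y ↔
      (memCount E X = 0 ∧ memCount E Y = 0) ∨ (2 ≤ memCount E X ∧ 2 ≤ memCount E Y) := by
  rw [← ofClutter_lab_eq_zero_iff E X, ← ofClutter_lab_eq_zero_iff E Y, ← ofClutter_lab_eq_last_iff E X,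
    ← ofClutter_lab_eq_last_iff E Y]
  constructor
  · intro h
    by_cases h0 : (MSunflower.ofClutter E).lab X = 0
    · exact Or.inl ⟨h0, h ▸ h0⟩
    by_cases ht : (MSunflower.ofClutter E).lab X = Fin.last (k + 1)
    · exact Or.inr ⟨ht, h ▸ ht⟩
    · exact absurd h (ofClutter_lab_ne_of_disjoint E hne hXY h0 ht)
  · rintro (⟨h1, h2⟩ | ⟨h1, h2⟩)
    · rw [h1, h2]
    · rw [h1, h2]

/-! ## The kernel as a function of the capped counts -/

/-- Model labels in `Fin 5` (`= Fin (3+2)`): bottom `0`, top `4`, and the petal `j+1` for block index `j` when the cap is `1`. [this work] -/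
def modelLab (j : Fin 3) (c : Fin 3) : Fin 5 := if c = 0 then 0 else if c = 1 then ⟨j.val + 1, by omega⟩ else 4

/-- The model reproduces `lbW` under the bottom-spectator kernel `qK` (27 cases). [this work] -/
theorem qK_modelLab : ∀ c : CType, qK 3 (modelLab 0 c.1) (modelLab 1 c.2.1) (modelLab 2 c.2.2) = lbW c := by decide

/-- Model label is bottom iff the cap is `0`. [this work] -/
theorem modelLab_eq_zero_iff : ∀ (j c : Fin 3), modelLab j c = 0 ↔ c = 0 := by decide

/-- Model label is top iff the cap is `2`. [this work] -/
theorem modelLab_eq_last_iff : ∀ (j c : Fin 3), modelLab j c = Fin.last (3 + 1) ↔ c = 2 := by decide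

/-- Model labels of different blocks agree iff both caps are `0` or both are `2`. [this work] -/
theorem modelLab_eq_iff : ∀ (j j' c c' : Fin 3), j ≠ j' →
    (modelLab j c = modelLab j' c' ↔ (c = 0 ∧ c' = 0) ∨ (c = 2 ∧ c' = 2)) := by decide

/-- **The bottom-spectator kernel on pairwise disjoint blocks is `lbW` of the capped counts.** [this work] -/
theorem qK_lab_eq_lbW (hne : ∀ i, (E i).Nonempty) {X Y Z : Finset α} (hXY : Disjoint X Y) (hXZ : Disjoint X Z)
    (hYZ : Disjoint Y Z) :
    qK k ((MSunflower.ofClutter E).lab X) ((MSunflower.ofClutter E).lab Y) ((MSunflower.ofClutter E).lab Z)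
      = lbW (capOf E X, capOf E Y, capOf E Z) := by
  rw [← qK_modelLab (capOf E X, capOf E Y, capOf E Z)]
  have hT : ∀ (j : Fin 3) (S : Finset α), (MSunflower.ofClutter E).lab S = Fin.last (k + 1) ↔
      modelLab j (capOf E S) = Fin.last (3 + 1) := fun j S => by
    rw [ofClutter_lab_eq_last_iff, modelLab_eq_last_iff, capOf_eq_two_iff]
  have hB : ∀ (j : Fin 3) (S : Finset α), (MSunflower.ofClutter E).lab S = 0 ↔ modelLab j (capOf E S) = 0 := fun j S => by
    rw [ofClutter_lab_eq_zero_iff, modelLab_eq_zero_iff, capOf_eq_zero_iff]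
  have hE : ∀ (j j' : Fin 3) (S S' : Finset α), j ≠ j' → Disjoint S S' →
      ((MSunflower.ofClutter E).lab S = (MSunflower.ofClutter E).lab S' ↔
        modelLab j (capOf E S) = modelLab j' (capOf E S')) := fun j j' S S' hjj' hSS' => by
    rw [ofClutter_lab_eq_lab_iff E hne hSS', modelLab_eq_iff j j' _ _ hjj', capOf_eq_zero_iff, capOf_eq_zero_iff,
      capOf_eq_two_iff, capOf_eq_two_iff]
  exact qK_congr (hT 0 X) (hB 0 X) (hT 1 Y) (hB 1 Y) (hT 2 Z) (hB 2 Z)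
    (hE 0 1 X Y (by decide) hXY) (hE 1 2 Y Z (by decide) hYZ) (hE 0 2 X Z (by decide) hXZ)

/-! ## The type vector and the type-vector form of `QKW` -/

/-- The ordered 3-partitions of the window `W` as disjoint pairs `(X, S)` with third block `W ∖ (X ∪ S)`. [this work] -/
def pparts (W : Finset α) : Finset (Finset α × Finset α) := (W.powerset ×ˢ W.powerset).filter fun q => Disjoint q.1 q.2

/-- The capped type of the ordered 3-partition `(X, S, W ∖ (X ∪ S))`. [this work] -/
def typeOf (W : Finset α) (q : Finset α × Finset α) : CType := (capOf E q.1, capOf E q.2, capOf E (W \ (q.1 ∪ q.2)))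

/-- **The TYPE VECTOR** of the clutter on the window `W`: the number of ordered 3-partitions of `W` of capped type `t`. [this work] -/
def typeCount (W : Finset α) (t : CType) : ℤ := ((pparts W).filter fun q => typeOf E W q = t).card

omit [Fintype α] in
/-- The type vector is nonnegative. [this work] -/
theorem typeCount_nonneg (W : Finset α) (t : CType) : 0 ≤ typeCount E W t := by
  unfold typeCount; positivity

/-- **Type-vector form of the bottom-spectator functional**: `QKW W = Σ_t lbW t · typeCount W t` (members nonempty). [this work] -/
theorem QKW_eq_sum_typeCount (hne : ∀ i, (E i).Nonempty) (W : Finset α) :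
    (MSunflower.ofClutter E).QKW W = ∑ t, lbW t * typeCount E W t := by
  have h1 : (MSunflower.ofClutter E).QKW W = ∑ q ∈ pparts W, lbW (typeOf E W q) := by
    unfold MSunflower.QKW
    rw [nested_eq_sum_filter]
    refine sum_congr rfl fun q hq => ?_
    have hq' := (mem_filter.1 hq)
    have hd : Disjoint q.1 q.2 := hq'.2
    have h13 : Disjoint q.1 (W \ (q.1 ∪ q.2)) := Finset.disjoint_sdiff.mono_left subset_union_left
    have h23 : Disjoint q.2 (W \ (q.1 ∪ q.2)) := Finset.disjoint_sdiff.mono_left subset_union_right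
    exact qK_lab_eq_lbW E hne hd h13 h23
  rw [h1, ← sum_fiberwise_of_maps_to (s := pparts W) (t := (univ : Finset CType)) (g := typeOf E W) (fun _ _ => mem_univ _)]
  refine sum_congr rfl fun t _ => ?_
  rw [sum_congr rfl fun q hq => by rw [(mem_filter.1 hq).2], sum_const, typeCount]
  simp [mul_comm]

omit [Fintype α] in
/-- Set identity behind the swap of the last two blocks. [this work] -/
theorem sdiff_union_sdiff_cancel {W X S : Finset α} (hS : S ⊆ W) (hd : Disjoint X S) : W \ (X ∪ (W \ (X ∪ S))) = S := by
  ext x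
  simp only [mem_sdiff, mem_union]
  constructor
  · rintro ⟨hxW, h⟩
    by_contra hx2
    by_cases hx1 : x ∈ X
    · exact h (Or.inl hx1)
    · exact h (Or.inr ⟨hxW, fun h' => h'.elim hx1 hx2⟩)
  · intro hx2
    refine ⟨hS hx2, fun h => h.elim (fun hx1 => disjoint_left.1 hd hx1 hx2) (fun h' => h'.2 (Or.inr hx2))⟩

omit [Fintype α] in
/-- Membership in `pparts`. [this work] -/
theorem mem_pparts {W : Finset α} {q : Finset α × Finset α} : q ∈ pparts W ↔ (q.1 ⊆ W ∧ q.2 ⊆ W) ∧ Disjoint q.1 q.2 := by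
  unfold pparts
  rw [mem_filter, mem_product, mem_powerset, mem_powerset]

omit [Fintype α] in
/-- The type vector is invariant under swapping the first two classes. [this work] -/
theorem typeCount_swap12 (W : Finset α) (t : CType) : typeCount E W (ctSwap12 t) = typeCount E W t := by
  obtain ⟨a, b, c⟩ := t
  have hsw : ∀ q : Finset α × Finset α, typeOf E W (q.2, q.1) = ctSwap12 (typeOf E W q) := by
    intro q
    show (capOf E q.2, capOf E q.1, capOf E (W \ (q.2 ∪ q.1))) = (capOf E q.2, capOf E q.1, capOf E (W \ (q.1 ∪ q.2)))
    rw [union_comm]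
  unfold typeCount
  congr 1
  refine card_nbij' (fun q => (q.2, q.1)) (fun q => (q.2, q.1)) ?_ ?_ (fun q _ => rfl) (fun q _ => rfl)
  · intro q hq
    rw [mem_coe, mem_filter, mem_pparts] at hq ⊢
    obtain ⟨⟨⟨h1, h2⟩, hd⟩, ht⟩ := hq
    refine ⟨⟨⟨h2, h1⟩, hd.symm⟩, ?_⟩
    rw [hsw, ht]; rfl
  · intro q hq
    rw [mem_coe, mem_filter, mem_pparts] at hq ⊢
    obtain ⟨⟨⟨h1, h2⟩, hd⟩, ht⟩ := hq
    refine ⟨⟨⟨h2, h1⟩, hd.symm⟩, ?_⟩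
    rw [hsw, ht]

omit [Fintype α] in
/-- The type vector is invariant under swapping the last two classes. [this work] -/
theorem typeCount_swap23 (W : Finset α) (t : CType) : typeCount E W (ctSwap23 t) = typeCount E W t := by
  obtain ⟨a, b, c⟩ := t
  have hsw : ∀ q : Finset α × Finset α, q.2 ⊆ W → Disjoint q.1 q.2 →
      typeOf E W (q.1, W \ (q.1 ∪ q.2)) = ctSwap23 (typeOf E W q) := by
    intro q h2 hd
    show (capOf E q.1, capOf E (W \ (q.1 ∪ q.2)), capOf E (W \ (q.1 ∪ (W \ (q.1 ∪ q.2)))))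
      = (capOf E q.1, capOf E (W \ (q.1 ∪ q.2)), capOf E q.2)
    rw [sdiff_union_sdiff_cancel h2 hd]
  have hmem : ∀ q : Finset α × Finset α, q ∈ pparts W → (q.1, W \ (q.1 ∪ q.2)) ∈ pparts W := by
    intro q hq
    rw [mem_pparts] at hq ⊢
    exact ⟨⟨hq.1.1, sdiff_subset⟩, Finset.disjoint_sdiff.mono_left subset_union_left⟩
  have hinv : ∀ q : Finset α × Finset α, q ∈ pparts W →
      ((q.1, W \ (q.1 ∪ q.2)).1, W \ ((q.1, W \ (q.1 ∪ q.2)).1 ∪ (q.1, W \ (q.1 ∪ q.2)).2)) = q := by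
    intro q hq
    rw [mem_pparts] at hq
    show (q.1, W \ (q.1 ∪ (W \ (q.1 ∪ q.2)))) = q
    rw [sdiff_union_sdiff_cancel hq.1.2 hq.2]
  unfold typeCount
  congr 1
  refine card_nbij' (fun q => (q.1, W \ (q.1 ∪ q.2))) (fun q => (q.1, W \ (q.1 ∪ q.2))) ?_ ?_
    (fun q hq => hinv q (mem_filter.1 (mem_coe.1 hq)).1) (fun q hq => hinv q (mem_filter.1 (mem_coe.1 hq)).1)
  · intro q hq
    rw [mem_coe, mem_filter] at hq ⊢
    obtain ⟨hq, ht⟩ := hq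
    refine ⟨hmem q hq, ?_⟩
    rw [hsw q (mem_pparts.1 hq).1.2 (mem_pparts.1 hq).2, ht]; rfl
  · intro q hq
    rw [mem_coe, mem_filter] at hq ⊢
    obtain ⟨hq, ht⟩ := hq
    refine ⟨hmem q hq, ?_⟩
    rw [hsw q (mem_pparts.1 hq).1.2 (mem_pparts.1 hq).2, ht]

/-- **Lemma B in type-vector form**: `0 ≤ QKW W` iff the Lemma-B functional of the type vector is nonnegative. [this work] -/
theorem QKW_nonneg_iff_typeCount (hne : ∀ i, (E i).Nonempty) (W : Finset α) :
    0 ≤ (MSunflower.ofClutter E).QKW W ↔ 0 ≤ ∑ t, lbW t * typeCount E W t := by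
  rw [QKW_eq_sum_typeCount E hne W]

end Summit.CriticalPhenomena.PercolationContinuityZ3.Theorems.SunflowerPartition
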